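import Summits.QuantumFields.YangMills.Theorems.BalabanUVNodesN18KingModelTorus
import Literature.MathematicalPhysics.QuantumFieldTheory.King1986.MinimizerHolderDecay

/-!
# BalabanUVNodes ∕ N18 — King's (3.75) mechanism: the three-factor knit with a PAIR-ANCHORED row (the Hölder quotient
# `∂_α(x, y)` on the left external line decays in `dist({x, y}, ·)`), the middle line by name, and the Hölder-line
# constants made uniform in the scale (Track A, DAG node N18 = NE5 `T4OutputRate.NE5 EA EB W κ θ C₅` :211; cluster K4;
# the -a∕-b loop on the PRINTED MODEL, fifth display)

HONEST FRAMING.  Count-neutral kernel bookkeeping (seat pub-ymgap-dag-n18-a g5; `--supports stmt-QuantumFields-19182`).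
King's A = 0 scalar MODEL of the NE5 mechanism (template literature, published and proved) — NOT Bałaban's covariant
one-step outputs `E^{(j)}(X; g, U)`, for which NE5 is NOT IN PRINT and has no tree producer (NODE O 0∕1); NOT a node
discharge; finite tori; nothing continuum ∕ ℝ⁴ ∕ OS ∕ mass-gap ∕ Clay.  THEOREMS ONLY: 0 `def`, 0 `sorry`, standard axioms.

THE POINT.  King p. 665, Prop. 3.9, third display: «|(∂_α(x′, y′)G^{η′}_{(j)})(z′) − (∂_α(x, y)G^η_{(j)})(z)|,
|(∂_α(x′, y′)∂^{η′}_μG^{η′}_{(j)})(z′) − (∂_α(x, y)∂^η_μG^η_{(j)})(z)| ≦ CL^{−γk}{(L^jη)^{2−d−α−γ}, (L^jη)^{1−d−α−γ}}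
exp[−δ₀ dist({x, y}, z)]. (3.75)», with «(∂_α(x, y)G)(z) = |x − y|^{−α}{G(x, z) − G(y, z)} (3.62)».  In the (4.42) expansion
`G^{(j)}_k(x, y) = Σ_{z,w} ℋ_j(x, z)·C^{(j)}(z, w)·ℋ_j(y, w)` the Hölder quotient lands on the LEFT ROW ONLY:
`(∂_α(x, y)G^{(j)}_k)(z) = Σ_{u,w} [|x − y|^{−α}(ℋ_j(x, u) − ℋ_j(y, u))]·C^{(j)}(u, w)·ℋ_j(z, w)`, and that row decays in the
distance from the PAIR `{B(x), B(y)}` (n18-b's file 13 `King1986/MinimizerHolderDecay`: `holder_kernel_decay_blocks`,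
`king_prop38_holder_torus_blocks`, rate `min(|B(x) − b|, |B(y) − b|)`), not from one block.  The g3∕g4 knit
(`N18KingModelScales.bilin_decay_bound` → `ne5_of_threeFactorRates_lemma45`) anchors the row at ONE position `p X`.  This
file is the PAIR-ANCHORED twin, reusing the one-anchor bound BY NAME (split the row by which anchor is nearer):
* §1 `bilin_decay_bound_pair` (`|u ⬝ (E v)| ≤ 2A₁θA₂V²e^{−(κ∕2)min(ρ(p₁,r), ρ(p₂,r))}` when
  `|u z| ≤ A₁e^{−κ·min(ρ(p₁, q z), ρ(p₂, q z))}`), `bilin3_rate_pair` ((4.43) through positions with a pair-anchored row).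
* §2 `ne5_of_threeFactorRates_pair` — the multi-scale knit: `C.d X ≤ min(ρ(p₁ X, r X), ρ(p₂ X, r X))` (King's
  `dist({x, y}, z)`) ⟹ `NE5 EA EB W (κ∕2) θ (2(cA·c·b + a·cC·b + a·c·cB)V²)`, ONE `θ` for all scales.
* §3 `ne5_of_threeFactorRates_lemma45_pair` — the middle line BY NAME on the torus (`king_cov_decay_torus`,
  `king_lemma45_torus`, `tdistT_sumBound`, as in g3's `ne5_of_threeFactorRates_lemma45`), outer lines as binders.
* §4 the Hölder lines' constants uniform in `K, n`: `fprop38RateConst_mono`, `fprop38Const_le_unif`, `sqrt_rate_le_unif`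
  (`√(C(K,n)·(L^K)^{−γ}·c) ≤ √(c·C_unif)·(L^{−γ∕2})^K` for ANY `C(K, n) ≤ C_unif` — the pattern of
  `N18KingModelTorus.outerRate_le_unif`, stated once for all four lines of (3.71)).
The torus theorems ((3.75) both lines for King's ACTUAL operators, unconditional, and their literal inhabitants) are the
companion file `BalabanUVNodesN18KingModelTorusHolder`.
NOT COVERED ∕ PINS (standing, ref-B READ #66∕#73∕#110∕#238): A = 0, `g`∕`U` unread; periodic b.c.; `j = 0`; King's
rescaling (2.20) and the powers `(L^jη)^{2−d−α−γ}`; (3.74) (the contour operator `G(Γ, b)`, U(1)-specific, not in the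
tree); the bearing on Bałaban's `E^{(j)}(X; g, U)` is NIL (NODE O + rows NE2∕NE3).

Sources: C. King, Commun. Math. Phys. **102** (1986) 649–677 [King1986] — Prop. 3.9 (3.75) p. 665 (page image
`b2b-balaban-template/king-renders/1986-cmp102-king-u1-higgs-I-p017-x2.png` read as an image by this seat), (3.62) p. 663,
(4.41)–(4.43) p. 675, Prop. 3.8 (3.71) lines 3–4 p. 664, Lemma 4.5 (4.38) p. 674; T. Bałaban, Commun. Math. Phys. **109**
(1987) 249–301 [Balaban1987RG1] — Thm 1 p. 259 (uniformity in ε, the only printed trace of NE5).  No claim about the mass gap.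
-/

noncomputable section

namespace Summit.QuantumFields.YangMills.BalabanUVNodes.N18KingModelScalesPair

open Real Matrix
open Literature.MathematicalPhysics.QuantumFieldTheory.Balaban1983to89.T4OutputRate (Carriers Functional NE5)
open Literature.MathematicalPhysics.QuantumFieldTheory.Balaban1983to89.B5Prop11Plancherel (Tor fine)
open Literature.MathematicalPhysics.QuantumFieldTheory.Balaban1983to89.B4Sect5Proof (latticeConst)
open Literature.MathematicalPhysics.QuantumFieldTheory.King1986
  (aK exp_decay_mono lemma43Const nearRateConst centralRateConst fnearRateConst fcentralRateConst fprop38RateConst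
    fprop38PosConst aliasConst aliasTerm_nonneg alias_sum_le)
open Literature.MathematicalPhysics.QuantumFieldTheory.King1986.Torus
  (effLaplacian blockProj tdistT tdistT_isPseudoDist tdistT_sumBound K45 K45_nonneg delta45 gam0L gam0L_pos kapCT
    aminL_le_aK king_lemma45_torus)
open Summit.QuantumFields.YangMills.BalabanUVNodes.N18KingModel
  (lemma43Const_le_unif rpow_neg_natPow kingTheta_pos kingTheta_eq_sq sqrt_mul_sq_mul)
open Summit.QuantumFields.YangMills.BalabanUVNodes.N18KingModelScales
  (bilin_decay_bound bilin3_sub_bilin3 king_cov_decay_torus inv_pow_le_kingTheta_pow delta45_le_kapCT)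

/-! ## §1 The three-factor bound with a PAIR-ANCHORED row -/

section Bilinear

variable {β P : Type*} [Fintype β]

/-- **(4.41) with a pair-anchored row.**  If the row decays in the distance from the NEARER of two anchors `p₁, p₂`,
`|u z| ≤ A₁e^{−κ·min(ρ(p₁, q z), ρ(p₂, q z))}` (King's `exp[−δ₀dist({x, y}, z)]` for the Hölder quotient `∂_α(x, y)` of the
left external line), the kernel `E` and the column `v` as in `N18KingModelScales.bilin_decay_bound`, then
`|u ⬝ (E v)| ≤ 2·A₁θA₂V²·e^{−(κ∕2)·min(ρ(p₁, r), ρ(p₂, r))}`.  Proof: split `u = u₁ + u₂` according to which anchor is nearer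
and apply the one-anchor bound to each piece. [cite: King1986, (4.41) p.675 and (3.75) p.665] -/
theorem bilin_decay_bound_pair (ρ : P → P → ℝ) (hρ0 : ∀ p q, 0 ≤ ρ p q) (hρtri : ∀ p q r, ρ p r ≤ ρ p q + ρ q r)
    (q : β → P) (p₁ p₂ r : P) (u v : β → ℝ) (E : Matrix β β ℝ) {κ A₁ θ A₂ V : ℝ} (hκ : 0 ≤ κ)
    (hA₁ : 0 ≤ A₁) (hθ : 0 ≤ θ) (hA₂ : 0 ≤ A₂)
    (hu : ∀ z, |u z| ≤ A₁ * Real.exp (-(κ * min (ρ p₁ (q z)) (ρ p₂ (q z)))))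
    (hE : ∀ z w, |E z w| ≤ θ * Real.exp (-(κ * ρ (q z) (q w))))
    (hv : ∀ w, |v w| ≤ A₂ * Real.exp (-(κ * ρ (q w) r)))
    (hV : ∀ s : P, ∑ z, Real.exp (-(κ / 2 * ρ s (q z))) ≤ V) :
    |u ⬝ᵥ (E *ᵥ v)| ≤ 2 * (A₁ * θ * A₂ * V ^ 2) * Real.exp (-(κ / 2 * min (ρ p₁ r) (ρ p₂ r))) := by
  classical
  -- split the row by the nearer anchor
  set u₁ : β → ℝ := fun z => if ρ p₁ (q z) ≤ ρ p₂ (q z) then u z else 0 with hu₁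
  set u₂ : β → ℝ := fun z => if ρ p₁ (q z) ≤ ρ p₂ (q z) then 0 else u z with hu₂
  have hsplit : u = u₁ + u₂ := by
    funext z
    simp only [hu₁, hu₂, Pi.add_apply]
    split_ifs <;> simp
  have h1 : ∀ z, |u₁ z| ≤ A₁ * Real.exp (-(κ * ρ p₁ (q z))) := by
    intro z
    simp only [hu₁]
    split_ifs with h
    · have h' := hu z
      rwa [min_eq_left h] at h'
    · rw [abs_zero]; positivity
  have h2 : ∀ z, |u₂ z| ≤ A₁ * Real.exp (-(κ * ρ p₂ (q z))) := by
    intro z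
    simp only [hu₂]
    split_ifs with h
    · rw [abs_zero]; positivity
    · have h' := hu z
      rwa [min_eq_right (le_of_lt (not_le.mp h))] at h'
  have b1 := bilin_decay_bound ρ hρ0 hρtri q p₁ r u₁ v E hκ hA₁ hθ hA₂ h1 hE hv hV
  have b2 := bilin_decay_bound ρ hρ0 hρtri q p₂ r u₂ v E hκ hA₁ hθ hA₂ h2 hE hv hV
  have hc : 0 ≤ A₁ * θ * A₂ * V ^ 2 := by positivity
  have e1 : Real.exp (-(κ / 2 * ρ p₁ r)) ≤ Real.exp (-(κ / 2 * min (ρ p₁ r) (ρ p₂ r))) :=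
    Real.exp_le_exp.mpr (neg_le_neg (mul_le_mul_of_nonneg_left (min_le_left _ _) (by positivity)))
  have e2 : Real.exp (-(κ / 2 * ρ p₂ r)) ≤ Real.exp (-(κ / 2 * min (ρ p₁ r) (ρ p₂ r))) :=
    Real.exp_le_exp.mpr (neg_le_neg (mul_le_mul_of_nonneg_left (min_le_right _ _) (by positivity)))
  rw [hsplit, add_dotProduct]
  calc |u₁ ⬝ᵥ (E *ᵥ v) + u₂ ⬝ᵥ (E *ᵥ v)| ≤ |u₁ ⬝ᵥ (E *ᵥ v)| + |u₂ ⬝ᵥ (E *ᵥ v)| := abs_add_le _ _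
    _ ≤ A₁ * θ * A₂ * V ^ 2 * Real.exp (-(κ / 2 * ρ p₁ r))
        + A₁ * θ * A₂ * V ^ 2 * Real.exp (-(κ / 2 * ρ p₂ r)) := add_le_add b1 b2
    _ ≤ A₁ * θ * A₂ * V ^ 2 * Real.exp (-(κ / 2 * min (ρ p₁ r) (ρ p₂ r)))
        + A₁ * θ * A₂ * V ^ 2 * Real.exp (-(κ / 2 * min (ρ p₁ r) (ρ p₂ r))) :=
        add_le_add (mul_le_mul_of_nonneg_left e1 hc) (mul_le_mul_of_nonneg_left e2 hc)
    _ = 2 * (A₁ * θ * A₂ * V ^ 2) * Real.exp (-(κ / 2 * min (ρ p₁ r) (ρ p₂ r))) := by ring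

/-- **(4.43) THROUGH POSITIONS WITH A PAIR-ANCHORED ROW.**  Rows `u` (run A), `u′` (run B) decaying from the nearer of
the anchors `p₁, p₂` (the blocks of the Hölder pair `x, y`), middle kernels `E, E′`, columns `v, v′` anchored at `r`;
sizes `a, c, c, b`, one-line differences `εA, εC, εB`, decay `κ`, lattice sums `V` ⟹ `|u′⬝(E′v′) − u⬝(Ev)| ≤
2(εA·c·b + a·εC·b + a·c·εB)·V²·e^{−(κ∕2)·min(ρ(p₁,r), ρ(p₂,r))}` — the three one-line replacements of p. 675
(`N18KingModelScales.bilin3_sub_bilin3`) bounded by §1's pair-anchored (4.41). [cite: King1986, (4.42)–(4.43) p.675, (3.75) p.665] -/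
theorem bilin3_rate_pair (ρ : P → P → ℝ) (hρ0 : ∀ p q, 0 ≤ ρ p q) (hρtri : ∀ p q r, ρ p r ≤ ρ p q + ρ q r)
    (q : β → P) (p₁ p₂ r : P) (u u' v v' : β → ℝ) (E E' : Matrix β β ℝ) {κ a c b εA εC εB V : ℝ} (hκ : 0 ≤ κ)
    (ha : 0 ≤ a) (hc : 0 ≤ c) (hb : 0 ≤ b) (hεA : 0 ≤ εA) (hεC : 0 ≤ εC) (hεB : 0 ≤ εB)
    (hu : ∀ z, |u z| ≤ a * Real.exp (-(κ * min (ρ p₁ (q z)) (ρ p₂ (q z)))))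
    (hE : ∀ z w, |E z w| ≤ c * Real.exp (-(κ * ρ (q z) (q w))))
    (hE' : ∀ z w, |E' z w| ≤ c * Real.exp (-(κ * ρ (q z) (q w))))
    (hv' : ∀ w, |v' w| ≤ b * Real.exp (-(κ * ρ (q w) r)))
    (hdu : ∀ z, |u' z - u z| ≤ εA * Real.exp (-(κ * min (ρ p₁ (q z)) (ρ p₂ (q z)))))
    (hdE : ∀ z w, |E' z w - E z w| ≤ εC * Real.exp (-(κ * ρ (q z) (q w))))
    (hdv : ∀ w, |v' w - v w| ≤ εB * Real.exp (-(κ * ρ (q w) r)))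
    (hV : ∀ s : P, ∑ z, Real.exp (-(κ / 2 * ρ s (q z))) ≤ V) :
    |u' ⬝ᵥ (E' *ᵥ v') - u ⬝ᵥ (E *ᵥ v)|
      ≤ 2 * ((εA * c * b + a * εC * b + a * c * εB) * V ^ 2)
        * Real.exp (-(κ / 2 * min (ρ p₁ r) (ρ p₂ r))) := by
  have h1 := bilin_decay_bound_pair ρ hρ0 hρtri q p₁ p₂ r (u' - u) v' E' hκ hεA hc hb
    (fun z => by rw [Pi.sub_apply]; exact hdu z) hE' hv' hV
  have h2 := bilin_decay_bound_pair ρ hρ0 hρtri q p₁ p₂ r u v' (E' - E) hκ ha hεC hb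
    hu (fun z w => by rw [Matrix.sub_apply]; exact hdE z w) hv' hV
  have h3 := bilin_decay_bound_pair ρ hρ0 hρtri q p₁ p₂ r u (v' - v) E hκ ha hc hεB
    hu hE (fun w => by rw [Pi.sub_apply]; exact hdv w) hV
  rw [bilin3_sub_bilin3]
  calc |(u' - u) ⬝ᵥ (E' *ᵥ v') + u ⬝ᵥ ((E' - E) *ᵥ v') + u ⬝ᵥ (E *ᵥ (v' - v))|
      ≤ |(u' - u) ⬝ᵥ (E' *ᵥ v') + u ⬝ᵥ ((E' - E) *ᵥ v')| + |u ⬝ᵥ (E *ᵥ (v' - v))| := abs_add_le _ _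
    _ ≤ |(u' - u) ⬝ᵥ (E' *ᵥ v')| + |u ⬝ᵥ ((E' - E) *ᵥ v')| + |u ⬝ᵥ (E *ᵥ (v' - v))| := by
        gcongr
        exact abs_add_le _ _
    _ ≤ 2 * (εA * c * b * V ^ 2) * Real.exp (-(κ / 2 * min (ρ p₁ r) (ρ p₂ r)))
          + 2 * (a * εC * b * V ^ 2) * Real.exp (-(κ / 2 * min (ρ p₁ r) (ρ p₂ r)))
          + 2 * (a * c * εB * V ^ 2) * Real.exp (-(κ / 2 * min (ρ p₁ r) (ρ p₂ r))) := by
        gcongr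
    _ = 2 * ((εA * c * b + a * εC * b + a * c * εB) * V ^ 2)
          * Real.exp (-(κ / 2 * min (ρ p₁ r) (ρ p₂ r))) := by ring

end Bilinear

/-! ## §2 THE KNIT: per-scale three-factor read-outs with a pair-anchored row ⟹ `NE5` with ONE `θ` -/

section MultiScale

variable {C : Carriers} {EA : Functional C C.BgA} {EB : Functional C C.BgB} {W : Set (ℕ → ℝ)}
  {β : ℕ → Type*} [∀ j, Fintype (β j)] {P : ℕ → Type*}

/-- **KING'S (3.75) MECHANISM AS A MULTI-SCALE `NE5` INHABITANT.**  Any carriers `C`; a domain `X` of scale `j` reads a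
PAIR of row anchors `p₁ X`, `p₂ X` (the blocks of the Hölder pair) and a column anchor `r X`, with tree length
`C.d X ≤ min(ρ_j(p₁ X, r X), ρ_j(p₂ X, r X))` (King's `dist({x, y}, z)`); run A's output at `X` is `u_A(X) ⬝ (C_A(X) v_A(X))`
with the row decaying from the nearer anchor, run B's the primed one; undifferenced sizes `a, c, c, b`, one-line rates
`cA·θ^j`, `cC·θ^j`, `cB·θ^j`, common decay `κ`, scale-uniform lattice sums `V` ⟹
`NE5 EA EB W (κ∕2) θ (2(cA·c·b + a·cC·b + a·c·cB)·V²)`.  `W`, backgrounds, transport unread (A = 0 model).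
[cite: King1986, Prop. 3.9 (3.75) p.665 and (4.42)–(4.43) p.675] -/
theorem ne5_of_threeFactorRates_pair (ρ : (j : ℕ) → P j → P j → ℝ) (hρ0 : ∀ j p q, 0 ≤ ρ j p q)
    (hρtri : ∀ j p q r, ρ j p r ≤ ρ j p q + ρ j q r) (q : (j : ℕ) → β j → P j)
    (p₁ p₂ r : (X : C.Dom) → P (C.scale X)) (uA uB vA vB : (X : C.Dom) → β (C.scale X) → ℝ)
    (CA CB : (X : C.Dom) → Matrix (β (C.scale X)) (β (C.scale X)) ℝ)
    {κ θ a c b cA cC cB V : ℝ} (hκ : 0 ≤ κ) (hθ : 0 ≤ θ) (ha : 0 ≤ a) (hc : 0 ≤ c) (hb : 0 ≤ b)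
    (hcA : 0 ≤ cA) (hcC : 0 ≤ cC) (hcB : 0 ≤ cB)
    (hu : ∀ X z, |uA X z| ≤ a * Real.exp (-(κ * min (ρ _ (p₁ X) (q _ z)) (ρ _ (p₂ X) (q _ z)))))
    (hCA : ∀ X z w, |CA X z w| ≤ c * Real.exp (-(κ * ρ _ (q _ z) (q _ w))))
    (hCB : ∀ X z w, |CB X z w| ≤ c * Real.exp (-(κ * ρ _ (q _ z) (q _ w))))
    (hv : ∀ X w, |vB X w| ≤ b * Real.exp (-(κ * ρ _ (q _ w) (r X))))
    (hdu : ∀ X z, |uB X z - uA X z|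
      ≤ cA * θ ^ C.scale X * Real.exp (-(κ * min (ρ _ (p₁ X) (q _ z)) (ρ _ (p₂ X) (q _ z)))))
    (hdC : ∀ X z w, |CB X z w - CA X z w| ≤ cC * θ ^ C.scale X * Real.exp (-(κ * ρ _ (q _ z) (q _ w))))
    (hdv : ∀ X w, |vB X w - vA X w| ≤ cB * θ ^ C.scale X * Real.exp (-(κ * ρ _ (q _ w) (r X))))
    (hV : ∀ j (s : P j), ∑ z, Real.exp (-(κ / 2 * ρ j s (q j z))) ≤ V)
    (hd : ∀ X, C.d X ≤ min (ρ _ (p₁ X) (r X)) (ρ _ (p₂ X) (r X)))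
    (hEA : ∀ g U X, EA g U X = uA X ⬝ᵥ (CA X *ᵥ vA X))
    (hEB : ∀ g U X, EB g U X = uB X ⬝ᵥ (CB X *ᵥ vB X)) :
    NE5 EA EB W (κ / 2) θ (2 * ((cA * c * b + a * cC * b + a * c * cB) * V ^ 2)) := by
  intro g _ U X
  rw [hEA, hEB, abs_sub_comm]
  have hθj : 0 ≤ θ ^ C.scale X := pow_nonneg hθ _
  have h := bilin3_rate_pair (ρ (C.scale X)) (hρ0 _) (hρtri _) (q _) (p₁ X) (p₂ X) (r X) (uA X) (uB X) (vA X)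
    (vB X) (CA X) (CB X) hκ ha hc hb (mul_nonneg hcA hθj) (mul_nonneg hcC hθj) (mul_nonneg hcB hθj)
    (hu X) (hCA X) (hCB X) (hv X) (hdu X) (hdC X) (hdv X) (hV _)
  refine h.trans ?_
  have hK : 0 ≤ 2 * ((cA * c * b + a * cC * b + a * c * cB) * V ^ 2) * θ ^ C.scale X := by positivity
  have hexp : Real.exp (-(κ / 2 * min (ρ _ (p₁ X) (r X)) (ρ _ (p₂ X) (r X)))) ≤ Real.exp (-(κ / 2 * C.d X)) :=
    Real.exp_le_exp.mpr (neg_le_neg (mul_le_mul_of_nonneg_left (hd X) (by positivity)))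
  calc 2 * ((cA * θ ^ C.scale X * c * b + a * (cC * θ ^ C.scale X) * b + a * c * (cB * θ ^ C.scale X)) * V ^ 2)
          * Real.exp (-(κ / 2 * min (ρ _ (p₁ X) (r X)) (ρ _ (p₂ X) (r X))))
      = 2 * ((cA * c * b + a * cC * b + a * c * cB) * V ^ 2) * θ ^ C.scale X
          * Real.exp (-(κ / 2 * min (ρ _ (p₁ X) (r X)) (ρ _ (p₂ X) (r X)))) := by ring
    _ ≤ 2 * ((cA * c * b + a * cC * b + a * c * cB) * V ^ 2) * θ ^ C.scale X * Real.exp (-(κ / 2 * C.d X)) :=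
        mul_le_mul_of_nonneg_left hexp hK

end MultiScale

/-! ## §3 The MIDDLE line BY NAME on the torus (pair-anchored rows) -/

section KingMiddle

variable {d : ℕ} {C : Carriers} {EA : Functional C C.BgA} {EB : Functional C C.BgB} {W : Set (ℕ → ℝ)}

/-- **(3.75)'s ASSEMBLY ON THE TORUS, MIDDLE LINE DISCHARGED BY NAME.**  King's actual `C^{(j)} = (Δ^{(j)} + aL⁻²Q*Q)⁻¹`,
`C^{(j+n)}` on the scale-`j` torus (`j = scale X ≥ 1`, `L ≥ 2`, `a, m² > 0`, `n ≥ 1`, `γ ≤ 1`); run A's output at `X` =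
`u_A(X) ⬝ (C^{(j)} v_A(X))`, run B's = `u_B(X) ⬝ (C^{(j+n)} v_B(X))`, the ROWS anchored at the PAIR `p₁ X, p₂ X` (sizes `sA`,
rate `cA·(L^{−γ})^j`, decay from the nearer anchor), the columns at `r X` (size `sB`, rate `cB·(L^{−γ})^j`), common decay
`0 < κ ≤ δ₄₅`, tree length `≤ min(|p₁ X − r X|, |p₂ X − r X|)`.  BY NAME: middle size∕decay `king_cov_decay_torus`, middle
rate `king_lemma45_torus` (`L^{−j} ≤ (L^{−γ})^j`), lattice sums `tdistT_sumBound`.  THEN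
`NE5 EA EB W (κ∕2) (L^{−γ}) (2(cA·(2∕γ₀)·sB + sA·K₄₅·sB + sA·(2∕γ₀)·cB)·K_d(κ∕2)²)`, uniform in `j`, the tori, `m²`.
A = 0 MODEL, periodic b.c. [cite: King1986, Prop. 3.9 (3.75) p.665, (4.42)–(4.43) p.675, Lemma 4.5 (4.38) p.674] -/
theorem ne5_of_threeFactorRates_lemma45_pair (L : ℕ) [NeZero L] (hL : 2 ≤ L) {a m2 : ℝ} (ha : 0 < a) (hm : 0 < m2)
    {n : ℕ} (hn : 1 ≤ n) (M : ℕ → Fin d → ℕ) [∀ j μ, NeZero (M j μ)] {γ : ℝ} (hγ1 : γ ≤ 1)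
    (hsc : ∀ X : C.Dom, 1 ≤ C.scale X)
    (p₁ p₂ r : (X : C.Dom) → Tor (fine L (M (C.scale X))))
    (uA uB vA vB : (X : C.Dom) → Tor (fine L (M (C.scale X))) → ℝ)
    (CA CB : (X : C.Dom) → Matrix (Tor (fine L (M (C.scale X)))) (Tor (fine L (M (C.scale X)))) ℝ)
    (hCAdef : ∀ X, CA X = (effLaplacian (L ^ C.scale X) (fine L (M (C.scale X))) (aK a L (C.scale X))
          (((L ^ C.scale X : ℕ) : ℝ) ^ 2) m2 + (a * ((L : ℝ) ^ 2)⁻¹) • blockProj L (M (C.scale X)))⁻¹)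
    (hCBdef : ∀ X, CB X = (effLaplacian (L ^ n * L ^ C.scale X) (fine L (M (C.scale X))) (aK a L (C.scale X + n))
          (((L ^ n * L ^ C.scale X : ℕ) : ℝ) ^ 2) m2 + (a * ((L : ℝ) ^ 2)⁻¹) • blockProj L (M (C.scale X)))⁻¹)
    {κ sA sB cA cB : ℝ} (hκ : 0 < κ) (hκδ : κ ≤ delta45 d a L) (hsA : 0 ≤ sA) (hsB : 0 ≤ sB)
    (hcA : 0 ≤ cA) (hcB : 0 ≤ cB)
    (hu : ∀ X z, |uA X z| ≤ sA * Real.exp (-(κ * min (tdistT _ (p₁ X) z) (tdistT _ (p₂ X) z))))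
    (hv : ∀ X w, |vB X w| ≤ sB * Real.exp (-(κ * tdistT _ w (r X))))
    (hdu : ∀ X z, |uB X z - uA X z|
      ≤ cA * ((L : ℝ) ^ (-γ)) ^ C.scale X * Real.exp (-(κ * min (tdistT _ (p₁ X) z) (tdistT _ (p₂ X) z))))
    (hdv : ∀ X w, |vB X w - vA X w| ≤ cB * ((L : ℝ) ^ (-γ)) ^ C.scale X * Real.exp (-(κ * tdistT _ w (r X))))
    (hd : ∀ X, C.d X ≤ min (tdistT _ (p₁ X) (r X)) (tdistT _ (p₂ X) (r X)))
    (hEA : ∀ g U X, EA g U X = uA X ⬝ᵥ (CA X *ᵥ vA X))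
    (hEB : ∀ g U X, EB g U X = uB X ⬝ᵥ (CB X *ᵥ vB X)) :
    NE5 EA EB W (κ / 2) ((L : ℝ) ^ (-γ))
      (2 * ((cA * (2 / gam0L d a L) * sB + sA * K45 d a L * sB + sA * (2 / gam0L d a L) * cB)
        * (latticeConst d (κ / 2)) ^ 2)) := by
  have hL1 : 1 ≤ L := by omega
  have hθ : 0 ≤ (L : ℝ) ^ (-γ) := (kingTheta_pos hL1 γ).le
  have hγ₀ : 0 < gam0L d a L := gam0L_pos ha hL
  have hsC : 0 ≤ 2 / gam0L d a L := by positivity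
  have hκ' : κ ≤ kapCT d a L := hκδ.trans (delta45_le_kapCT ha hL)
  -- the middle factors' undifferenced decay BY NAME (`king_cov_decay_torus`), weakened from `κ′` to `κ`
  have hCA : ∀ X z w, |CA X z w| ≤ 2 / gam0L d a L * Real.exp (-(κ * tdistT _ z w)) := by
    intro X z w
    obtain ⟨hlo, hhi⟩ := aminL_le_aK ha hL (hsc X)
    rw [hCAdef]
    exact (king_cov_decay_torus ha hm hL (L ^ C.scale X) hlo hhi (M (C.scale X)) z w).trans
      (exp_decay_mono hsC hκ' ((tdistT_isPseudoDist _).nonneg z w))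
  have hCB : ∀ X z w, |CB X z w| ≤ 2 / gam0L d a L * Real.exp (-(κ * tdistT _ z w)) := by
    intro X z w
    obtain ⟨hlo, hhi⟩ := aminL_le_aK ha hL (show 1 ≤ C.scale X + n by have := hsc X; omega)
    rw [hCBdef]
    exact (king_cov_decay_torus ha hm hL (L ^ n * L ^ C.scale X) hlo hhi (M (C.scale X)) z w).trans
      (exp_decay_mono hsC hκ' ((tdistT_isPseudoDist _).nonneg z w))
  -- the middle line's RATE: Lemma 4.5 BY NAME, `L^{-j} ≤ θ^j`, decay weakened from `δ₄₅` to `κ`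
  have hdC : ∀ X z w, |CB X z w - CA X z w|
      ≤ K45 d a L * ((L : ℝ) ^ (-γ)) ^ C.scale X * Real.exp (-(κ * tdistT _ z w)) := by
    intro X z w
    have h45 := king_lemma45_torus ha hm hL (hsc X) hn (M (C.scale X)) z w
    rw [hCAdef, hCBdef, abs_sub_comm]
    refine h45.trans ?_
    have hK : 0 ≤ K45 d a L := K45_nonneg a L
    have ht : 0 ≤ tdistT _ z w := (tdistT_isPseudoDist _).nonneg z w
    calc K45 d a L * ((L : ℝ) ^ C.scale X)⁻¹ * Real.exp (-(delta45 d a L * tdistT _ z w))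
        ≤ K45 d a L * ((L : ℝ) ^ (-γ)) ^ C.scale X * Real.exp (-(delta45 d a L * tdistT _ z w)) :=
          mul_le_mul_of_nonneg_right (mul_le_mul_of_nonneg_left (inv_pow_le_kingTheta_pow hL1 hγ1 _) hK)
            (Real.exp_pos _).le
      _ ≤ K45 d a L * ((L : ℝ) ^ (-γ)) ^ C.scale X * Real.exp (-(κ * tdistT _ z w)) :=
          exp_decay_mono (mul_nonneg hK (pow_nonneg hθ _)) hκδ ht
  -- the lattice sums BY NAME (uniform in the torus)
  have hV : ∀ (j : ℕ) (s : Tor (fine L (M j))),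
      ∑ z, Real.exp (-(κ / 2 * tdistT (fine L (M j)) s (id z))) ≤ latticeConst d (κ / 2) :=
    fun j s => tdistT_sumBound (fine L (M j)) (κ / 2) (half_pos hκ) s
  exact ne5_of_threeFactorRates_pair (β := fun j => Tor (fine L (M j))) (P := fun j => Tor (fine L (M j)))
    (fun j => tdistT (fine L (M j))) (fun j => (tdistT_isPseudoDist _).nonneg)
    (fun j => (tdistT_isPseudoDist _).triangle) (fun _ => id) p₁ p₂ r uA uB vA vB CA CB hκ.le hθ hsA hsC hsB hcA
    (K45_nonneg a L) hcB hu hCA hCB hv hdu hdC hdv hV hd hEA hEB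

end KingMiddle

/-! ## §4 The Hölder lines' constants, uniform in `K` and `n` -/

section Constants

variable {d : ℕ}

/-- King's factored rate constant (`MinimizerAliasRateFactor.fprop38RateConst`, the (3.71) lines 3–4 assembly) is
monotone in the Lemma 4.3 letter `θ` (it enters linearly with the nonnegative coefficients `c_E·C(d, β+γ−1)` and `c_E·π^β`).
[cite: King1986, Prop. 3.8 (3.71) p.664 with (4.22)–(4.31) pp.672–673] -/
theorem fprop38RateConst_mono {aA aB θ θ' K : ℝ} {dd : ℕ} {γ β cE rE : ℝ} (haA : 0 ≤ aA) (hK : 0 ≤ K)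
    (hcE : 0 ≤ cE) (hAC : 0 ≤ aliasConst dd (β + γ - 1)) (hθ : θ ≤ θ') :
    fprop38RateConst aA aB θ K dd γ β cE rE ≤ fprop38RateConst aA aB θ' K dd γ β cE rE := by
  have hpd : 0 ≤ (π / 2) ^ dd := pow_nonneg (by positivity) dd
  have h1 : nearRateConst aA θ dd γ ≤ nearRateConst aA θ' dd γ := by
    unfold nearRateConst
    exact mul_le_mul_of_nonneg_left (by nlinarith [pi_pos]) (mul_nonneg haA hpd)
  have h2 : centralRateConst aA θ K dd γ ≤ centralRateConst aA θ' K dd γ := by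
    unfold centralRateConst
    refine mul_le_mul_of_nonneg_left ?_ hpd
    nlinarith [mul_nonneg hK (sq_nonneg π)]
  have h1' : fnearRateConst aA θ dd γ cE rE ≤ fnearRateConst aA θ' dd γ cE rE := by
    unfold fnearRateConst
    linarith [mul_le_mul_of_nonneg_right h1 hcE]
  have hπβ : 0 ≤ π ^ β := Real.rpow_nonneg pi_pos.le β
  have h2' : fcentralRateConst aA θ K dd γ β cE rE ≤ fcentralRateConst aA θ' K dd γ β cE rE := by
    unfold fcentralRateConst
    linarith [mul_le_mul_of_nonneg_right (mul_le_mul_of_nonneg_right h2 hcE) hπβ]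
  unfold fprop38RateConst
  linarith [mul_le_mul_of_nonneg_right h1' hAC]

/-- **ONE CONSTANT FOR ALL SCALES (Hölder lines).**  For any factor letters `β, c_E ≥ 0, r_E, s_E` with `C(d, β+γ−1) ≥ 0`:
`C₁^E(k, n) + C₂^E ≤ C₅^E(a, L, d, γ, …) := fprop38RateConst a a Θ V d γ β c_E r_E + fprop38PosConst a V d γ β c_E s_E`,
`Θ = 2a((a(1 − L⁻²))⁻¹ + π²∕48 + 1∕3)` (`k, n ≥ 1`; `N18KingModel.lemma43Const_le_unif`).
[cite: King1986, Prop. 3.8 (3.71) p.664, Lemma 4.3 p.672, (2.13) p.653] -/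
theorem fprop38Const_le_unif {a : ℝ} (ha : 0 < a) {L : ℕ} (hL : 2 ≤ L) {k n : ℕ} (hk : 1 ≤ k) (hn : 1 ≤ n)
    {V γ β cE rE sE : ℝ} (hV : 0 ≤ V) (hcE : 0 ≤ cE) (hAC : 0 ≤ aliasConst d (β + γ - 1)) :
    fprop38RateConst a a (lemma43Const a L k n) V d γ β cE rE + fprop38PosConst a V d γ β cE sE
      ≤ fprop38RateConst a a (a * (2 * ((a * (1 - ((L : ℝ) ^ 2)⁻¹))⁻¹ + π ^ 2 / 48 + 1 / 3))) V d γ β cE rE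
        + fprop38PosConst a V d γ β cE sE := by
  have h := fprop38RateConst_mono (aB := a) (K := V) (dd := d) (γ := γ) (β := β) (cE := cE) (rE := rE) ha.le hV
    hcE hAC (lemma43Const_le_unif ha hL hk hn)
  linarith

/-- `0 ≤ C(d, s)` for `s < 1`, `d ≥ 1` ((4.22) bounds a nonnegative alias sum). [cite: King1986, (4.22) p.672] -/
theorem aliasConst_nonneg_of_lt_one (hd : 0 < d) {s : ℝ} (hs : s < 1) : 0 ≤ aliasConst d s :=
  (Finset.sum_nonneg fun j _ => aliasTerm_nonneg s _ j).trans
    (alias_sum_le hd hs (p := fun _ => 0) (fun μ => by rw [abs_zero]; exact pi_pos.le) 0)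

/-- **The square-root rate made uniform.**  For ANY scale-dependent constant `C(K, n) ≤ C_unif` and `c ≥ 0`:
`√(C(K,n)·(L^K)^{−γ}·c) ≤ √(c·C_unif)·(L^{−γ∕2})^K` (`(L^K)^{−γ} = ((L^{−γ∕2})^K)²`) — the step shared by
`N18KingModelTorus.outerRate_le_unif`, `N18KingModelTorusDeriv.douterRate_le_unif` and the two Hölder lines. [folklore] -/
theorem sqrt_rate_le_unif {Ck Cu c : ℝ} (hC : Ck ≤ Cu) (hc : 0 ≤ c) (L K : ℕ) (γ : ℝ) :
    Real.sqrt (Ck * ((L ^ K : ℕ) : ℝ) ^ (-γ) * c) ≤ Real.sqrt (c * Cu) * (((L : ℝ) ^ (-(γ / 2))) ^ K) := by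
  set s : ℝ := (L : ℝ) ^ (-(γ / 2)) with hs_def
  have hs : 0 ≤ s := Real.rpow_nonneg (Nat.cast_nonneg _) _
  have hrate : ((L ^ K : ℕ) : ℝ) ^ (-γ) = (s ^ K) ^ 2 := by
    rw [rpow_neg_natPow, kingTheta_eq_sq, ← pow_mul, ← pow_mul, mul_comm]
  rw [hrate, sqrt_mul_sq_mul (pow_nonneg hs _)]
  have hmono : Real.sqrt (Ck * c) ≤ Real.sqrt (c * Cu) := by
    rw [mul_comm Ck]
    exact Real.sqrt_le_sqrt (mul_le_mul_of_nonneg_left hC hc)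
  exact mul_le_mul_of_nonneg_right hmono (pow_nonneg hs _)

end Constants

end Summit.QuantumFields.YangMills.BalabanUVNodes.N18KingModelScalesPair

end
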